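import Literature.AnabelianGeometry.SemiGraphs.TemperedCompletionOpenSubgroups
import HarnessLib

/-!
# Profinite completions: restriction to an open subgroup of finite index

Mochizuki, *Semi-graphs of anabelioids*, Publ. RIMS **42** (2006) [SemiAnbd], §6 p. 69 ("we shall denote the
profinite completion of a group by means of a `∧`") and proof of Lemma 6.3 (ii) p. 70 ("replacing `F` by an
open subgroup of `F` of finite index") [cite: MochizukiSemiAnbd2006, §6 p.69, Lem 6.3 proof p.70]; used in
[IUTchI] Prop. 2.4 (i) p. 50 l. 33 ("the closure `Ĵ` of `J` in `Π̂_X` [satisfies] `Ĵ ∩ Δ^tp_X = J`" and "the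
natural surjection on pro-`Σ̂` completions `Ĵ ↠ Π̂_{𝔾_J}`" — i.e. `Ĵ` IS the profinite completion of the
finite-index open level `J`) [cite: Mochizuki2012, Prop 2.4(i) p.50].

PROOF-ONLY (abc-iut cell, prover abc-iut-L5-t11; no definitions, no facts): CLASSICAL topological group
theory over the interface `IsProfiniteCompletion` (`TemperedAnabelian.lean`).  For a profinite completion
`ι : F → F̂` and an OPEN subgroup `U ≤ F` of FINITE INDEX, any continuous homomorphism `ιU : U → Û` into
`Û :=` the closure of `ι(U)` in `F̂` agreeing with `ι` is again a profinite completion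
(`isProfiniteCompletion_restrict`): `Û` is compact Hausdorff totally disconnected (closed in `F̂`), `ι(U)` is
dense in it, open normal subgroups pull back to open subgroups, and every open normal finite-index `U' ⊴ U`
is cut out by the open normal subgroup `closure ι(U') ∩ Û` of `Û` (`comap_topologicalClosure_map` for the
open finite-index subgroup `U' ≤ F`; normality in `Û` because the elements normalising a closed subgroup form a
closed set containing the dense `ι(U)`).  Mathlib only.  Nothing here takes a side on [IUTchIII] Cor. 3.12.
-/

noncomputable section

namespace Literature.IUT.HodgeTheaters

namespace ProfiniteCompletionRestrict

open Topology
open Literature.AnabelianGeometry.SemiGraphs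

universe u v

/-- In a topological group, a CLOSED subgroup `H` conjugated into itself by every element of a dense subset
is normal: the set of `g` with `g H g⁻¹ ⊆ H` is closed (an intersection of preimages of `H`) and contains the
dense set (the step by which closures of images of normal subgroups in profinite completions are normal,
[SemiAnbd] §6 p. 69). [cite: MochizukiSemiAnbd2006, §6 p.69] -/
theorem normal_of_dense_conj {G : Type*} [Group G] [TopologicalSpace G] [IsTopologicalGroup G]
    (H : Subgroup G) (hH : IsClosed (H : Set G)) {S : Set G} (hS : Dense S)
    (hconj : ∀ g ∈ S, ∀ h ∈ H, g * h * g⁻¹ ∈ H) : H.Normal := by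
  have hcl : IsClosed {g : G | ∀ h ∈ H, g * h * g⁻¹ ∈ H} := by
    have : {g : G | ∀ h ∈ H, g * h * g⁻¹ ∈ H} =
        ⋂ h : H, (fun g : G => g * (h : G) * g⁻¹) ⁻¹' (H : Set G) := by
      ext g
      simp only [Set.mem_setOf_eq, Set.mem_iInter, Set.mem_preimage, SetLike.mem_coe, Subtype.forall]
    rw [this]
    exact isClosed_iInter fun h => hH.preimage (by fun_prop)
  have hall : ∀ g : G, ∀ h ∈ H, g * h * g⁻¹ ∈ H := fun g =>
    (hcl.closure_subset_iff.2 (fun g hg => hconj g hg)) (hS g)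
  exact ⟨fun h hh g => hall g h hh⟩

/-- Conjugation by a fixed element carrying a subgroup into itself carries its closure into itself
(continuity of `h ↦ g h g⁻¹`; closures in profinite completions, [SemiAnbd] §6 p. 69).
[cite: MochizukiSemiAnbd2006, §6 p.69] -/
theorem conj_mem_topologicalClosure_of_forall {G : Type*} [Group G] [TopologicalSpace G]
    [IsTopologicalGroup G] (K : Subgroup G) (g : G) (hg : ∀ k ∈ K, g * k * g⁻¹ ∈ K)
    (h : G) (hh : h ∈ K.topologicalClosure) : g * h * g⁻¹ ∈ K.topologicalClosure := by
  have hcont : Continuous fun x : G => g * x * g⁻¹ := by fun_prop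
  have hmaps : Set.MapsTo (fun x : G => g * x * g⁻¹) (K : Set G) (K : Set G) := fun k hk => hg k hk
  have hh' : h ∈ closure (K : Set G) := by
    rw [← Subgroup.topologicalClosure_coe]; exact hh
  have h2 : g * h * g⁻¹ ∈ closure (K : Set G) := hmaps.closure hcont hh'
  rw [← Subgroup.topologicalClosure_coe] at h2
  exact h2

variable {F : Type u} {Fhat : Type v} [Group F] [TopologicalSpace F] [IsTopologicalGroup F]
  [Group Fhat] [TopologicalSpace Fhat] [IsTopologicalGroup Fhat] {ι : F →ₜ* Fhat}

omit [IsTopologicalGroup F] in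
/-- `ι(U)` is dense in its closure `Û` (read as a subset of `Û`). [folklore] -/
private theorem dense_preimage_image (U : Subgroup F) (W : Subgroup Fhat)
    (hW : W = (U.map ι.toMonoidHom).topologicalClosure) :
    Dense ((Subtype.val : W → Fhat) ⁻¹' (ι '' (U : Set F))) := by
  rw [Subtype.dense_iff]
  intro w hw
  have hWset : (W : Set Fhat) = closure (ι '' (U : Set F)) := by
    rw [hW, Subgroup.topologicalClosure_coe, Subgroup.coe_map]; rfl
  have hw' : w ∈ closure (ι '' (U : Set F)) := by rw [← hWset]; exact hw
  refine closure_mono ?_ hw'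
  rintro _ ⟨x, hx, rfl⟩
  have hxW : ι x ∈ W := by rw [hW]; exact Subgroup.le_topologicalClosure _ ⟨x, hx, rfl⟩
  exact ⟨⟨ι x, hxW⟩, ⟨x, hx, rfl⟩, rfl⟩

/-- **Restriction of a profinite completion to an open subgroup of finite index.**  If `ι : F → F̂` is a
profinite completion (`IsProfiniteCompletion ι`), `U ≤ F` is open of finite index, `Û` is the closure of
`ι(U)` in `F̂`, and `ιU : U → Û` is a continuous homomorphism agreeing with `ι`, then `ιU` is a profinite
completion of `U`. [cite: MochizukiSemiAnbd2006, §6 p.69] -/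
theorem isProfiniteCompletion_restrict (hι : IsProfiniteCompletion ι) (U : Subgroup F)
    (hU : IsOpen (U : Set F)) [U.FiniteIndex] (W : Subgroup Fhat)
    (hW : W = (U.map ι.toMonoidHom).topologicalClosure) (ιU : U →ₜ* W)
    (hιU : ∀ u : U, ((ιU u : W) : Fhat) = ι (u : F)) : IsProfiniteCompletion ιU := by
  classical
  haveI : CompactSpace Fhat := hι.compactSpace
  haveI : T2Space Fhat := hι.t2Space
  haveI : TotallyDisconnectedSpace Fhat := hι.totallyDisconnectedSpace
  have hWcl : IsClosed (W : Set Fhat) := by rw [hW]; exact Subgroup.isClosed_topologicalClosure _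
  refine
    { compactSpace := isCompact_iff_compactSpace.1 hWcl.isCompact
      t2Space := inferInstance
      totallyDisconnectedSpace := inferInstance
      denseRange := ?_
      comap_surjective := ?_
      isOpen_comap := fun V => ?_ }
  · -- `ι(U)` is dense in its closure
    have hr : Set.range ιU = (Subtype.val : W → Fhat) ⁻¹' (ι '' (U : Set F)) := by
      ext w
      constructor
      · rintro ⟨u, rfl⟩
        exact ⟨u, u.2, (hιU u).symm⟩
      · rintro ⟨x, hx, hxw⟩
        refine ⟨⟨x, hx⟩, Subtype.ext ?_⟩
        rw [hιU]; exact hxw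
    rw [DenseRange, hr]
    exact dense_preimage_image U W hW
  · -- open normal finite-index subgroups of `U` are cut out by open normal subgroups of `Û`
    intro U' hU'
    haveI := hU'
    -- `U'` as a subgroup `U''` of `F`: open, of finite index, contained in `U`
    have hU''o : IsOpen ((U'.toSubgroup.map U.subtype : Subgroup F) : Set F) := by
      rw [Subgroup.coe_map]
      exact hU.isOpenMap_subtype_val _ U'.toOpenSubgroup.isOpen
    haveI hU''fi : (U'.toSubgroup.map U.subtype : Subgroup F).FiniteIndex := by
      constructor
      rw [Subgroup.index_map_subtype]
      exact mul_ne_zero hU'.index_ne_zero Subgroup.FiniteIndex.index_ne_zero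
    have hU''le : (U'.toSubgroup.map U.subtype : Subgroup F) ≤ U := Subgroup.map_subtype_le _
    -- its closure `V'` in `F̂`: open, closed, pulls back to `U''`, contained in `Û`
    have hV'o : IsOpen ((((U'.toSubgroup.map U.subtype).map ι.toMonoidHom).topologicalClosure :
        Subgroup Fhat) : Set Fhat) :=
      hι.isOpen_topologicalClosure_map _ hU''o
    have hV'cl : IsClosed ((((U'.toSubgroup.map U.subtype).map ι.toMonoidHom).topologicalClosure :
        Subgroup Fhat) : Set Fhat) :=
      Subgroup.isClosed_topologicalClosure _
    have hV'comap : (((U'.toSubgroup.map U.subtype).map ι.toMonoidHom).topologicalClosure).comap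
        ι.toMonoidHom = U'.toSubgroup.map U.subtype :=
      hι.comap_topologicalClosure_map _ hU''o
    -- `ι(U)` conjugates `V'` into itself
    have hnormS : ∀ g ∈ ι '' (U : Set F),
        ∀ h ∈ ((U'.toSubgroup.map U.subtype).map ι.toMonoidHom).topologicalClosure,
          g * h * g⁻¹ ∈ ((U'.toSubgroup.map U.subtype).map ι.toMonoidHom).topologicalClosure := by
      rintro _ ⟨x, hx, rfl⟩ h hh
      refine conj_mem_topologicalClosure_of_forall _ _ (fun k hk => ?_) h hh
      obtain ⟨y, hy, rfl⟩ := hk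
      obtain ⟨y', hy', rfl⟩ := hy
      have hmem : ((⟨x, hx⟩ * y' * ⟨x, hx⟩⁻¹ : U) : F) ∈ (U'.toSubgroup.map U.subtype : Subgroup F) :=
        ⟨_, U'.isNormal'.conj_mem y' hy' ⟨x, hx⟩, rfl⟩
      have heq : ι.toMonoidHom (((⟨x, hx⟩ * y' * ⟨x, hx⟩⁻¹ : U) : F)) =
          ι x * ι.toMonoidHom (U.subtype y') * (ι x)⁻¹ := by
        simp only [Subgroup.coe_mul, Subgroup.coe_inv, map_mul, map_inv, Subgroup.coe_subtype]
        rfl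
      exact ⟨_, hmem, heq⟩
    -- the open normal subgroup `V := V' ∩ Û` of `Û`
    have hVo : IsOpen ((((((U'.toSubgroup.map U.subtype).map ι.toMonoidHom).topologicalClosure).subgroupOf
        W : Subgroup W) : Set W)) := hV'o.preimage continuous_subtype_val
    have hVcl : IsClosed ((((((U'.toSubgroup.map U.subtype).map ι.toMonoidHom).topologicalClosure).subgroupOf
        W : Subgroup W) : Set W)) := hV'cl.preimage continuous_subtype_val
    have hVn : ((((U'.toSubgroup.map U.subtype).map ι.toMonoidHom).topologicalClosure).subgroupOf
        W).Normal :=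
      normal_of_dense_conj _ hVcl (dense_preimage_image U W hW) fun g hg h hh => hnormS g hg h hh
    refine ⟨{ toSubgroup :=
                (((U'.toSubgroup.map U.subtype).map ι.toMonoidHom).topologicalClosure).subgroupOf W,
              isOpen' := hVo, isNormal' := hVn }, ?_⟩
    ext u
    change u ∈ U'.toSubgroup ↔
      ((ιU u : W) : Fhat) ∈ ((U'.toSubgroup.map U.subtype).map ι.toMonoidHom).topologicalClosure
    rw [hιU]
    constructor
    · intro hu
      exact Subgroup.le_topologicalClosure _ ⟨u, ⟨u, hu, rfl⟩, rfl⟩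
    · intro hu
      have h1 : (u : F) ∈ (((U'.toSubgroup.map U.subtype).map ι.toMonoidHom).topologicalClosure).comap
          ι.toMonoidHom := hu
      rw [hV'comap] at h1
      obtain ⟨u', hu', hu'eq⟩ := h1
      have : u' = u := Subtype.ext hu'eq
      rw [← this]; exact hu'
  · -- open normal subgroups of `Û` pull back to open subgroups
    show IsOpen ((ιU : U → W) ⁻¹' (V : Set W))
    exact V.toOpenSubgroup.isOpen.preimage ιU.continuous

/-- The special case of `isProfiniteCompletion_restrict` with the target given literally as the closure
`(U.map ι).topologicalClosure` (no auxiliary `W`): a continuous homomorphism `ιU : U → closure ι(U)`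
agreeing with `ι` is a profinite completion of the open finite-index subgroup `U`.
[cite: MochizukiSemiAnbd2006, §6 p.69] -/
theorem isProfiniteCompletion_restrict' (hι : IsProfiniteCompletion ι) (U : Subgroup F)
    (hU : IsOpen (U : Set F)) [U.FiniteIndex]
    (ιU : U →ₜ* ↥((U.map ι.toMonoidHom).topologicalClosure))
    (hιU : ∀ u : U, ((ιU u : ↥((U.map ι.toMonoidHom).topologicalClosure)) : Fhat) = ι (u : F)) :
    IsProfiniteCompletion ιU :=
  isProfiniteCompletion_restrict hι U hU _ rfl ιU hιU

end ProfiniteCompletionRestrict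

end Literature.IUT.HodgeTheaters

end
-- build-lane enqueue re-land #2 (abc-iut-w4-d063 g4, 2026-08-26T08:5xZ; OPS-REQUESTS «STRANDED ACCEPT» class): no declaration changed; p425433/p429255 never received an olean, blocking p427758.
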